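import Summits.HodgeConjecture.CorCM.HypLiu418.A3Liu418GSInstance
import Summits.HodgeConjecture.CorCM.HypLiu418.A3Liu418GSThmD6OneCurve
import Literature.NumberTheory.Automorphic.Liu2021.AppendixC.EtaleBettiComparison
import Literature.NumberTheory.Automorphic.UnitaryGroupLevelTransport
import Literature.NumberTheory.Automorphic.UnitaryGroupArchFactor
import Literature.NumberTheory.Automorphic.UnitaryGroupArchEmbedding
import Literature.AlgebraicGeometry.ShimuraVarieties.UnitaryBallQuotientDatum
import Literature.NumberTheory.Automorphic.UnitaryCurveCohCotangentForms
import Literature.NumberTheory.Automorphic.UnitaryCurveConeFrameOfSig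
import Literature.NumberTheory.Automorphic.Liu2021.AppendixC.BettiPinningRealisation
import Summits.HodgeConjecture.HodgeConjecture.Theorems.F0AlbCmS1LevelRealisation
import Summits.HodgeConjecture.HodgeConjecture.Theorems.HLiu418S1MultOneFormsOfLetters
import Literature.NumberTheory.Automorphic.UnitaryCurveCohCotangentFormsConjRep
import Mathlib.RepresentationTheory.Intertwining
import Mathlib.RepresentationTheory.Invariants
import HarnessLib

-- ROAD (A) THEOREMS COPY (F0P5-plan (g0) ruling 2026-08-31T00:45:19Z, the 24833 precedent): this file is the `Theorems/` twin of the sub-sub-line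
-- `Cruxes/HLiu418/Lines/F0_AlbCmS1Betti.lean` (ed. 3), body verbatim in namespace `…F0AlbCmS1BettiHolds`, with NO `sorry`: `stub_S1_levelRealisation` ★ by name,
-- `stub_S1_multOneForms` by ★ p03 `S1MultOneFormsOfLetters.s1MultOneForms_of_seven_letters` with the printed-citation letters as HYPOTHESES BY THEIR
-- LITERATURE NAMES (5 after ★ p798131's conjugation transport: E1, E1′-hol, E2′θ, TP-hol, E₂-hol); head `stub_S1_betti_holds (hE1) (hE1'h) (hE2') (hDh) (hEh) : S1BettiShape`.
-- Edition history of the Lines file (ed. 1 registrar cure s355, ed. 2 level letter + ★ glue, ed. 3 `stub_S1_levelRealisation` by name): see the tree copy.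

/-!
# FLOOR-0 SUB-SUB-LINE `Cruxes/HLiu418/Lines/F0_AlbCmS1Betti` (THEOREMS COPY `…S1BettiHolds`, sorry-free modulo named letters) — the cut of `F0_AlbCm.stub_S1_betti : S1BettiShape` ([Liu2021, Prop. D.4 (1)] in
# Betti currency) into a REALISATION letter (S1-R, cone road) and a MULTIPLICITY-ONE-ON-FORMS letter (S1-E2), with the junction PROVED

Cell `hodgecm-mathlib`, crux item stmt-HodgeConjecture-24832 `HCCMUnconditional.HLiu418`, parent line `Cruxes/HLiu418/Lines/F0_AlbCm.lean`
(tree d758f6c35589a966; F0P5-plan (g0)), WAVE 3 seat F0P5-p01 (g0) = B2 seat 1 «CARRIER LETTER S1-R on the CONE road» (BRIEFS-WAVE3 8ee976e3).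
HONEST LABEL: HC_CM is proved only modulo the 7 printed citations until rung 0 closes; this file discharges none of them and asserts nothing printed:
two `def … : Prop` letters, two `sorry`-stubs, and kernel-checked glue.

THE CUT.  `S1BettiShape` (parent :97–131) = «`rank_ℂ Hom_{ℂ[G]}(ω⋆_lab, H) ≤ 1` for every Betti pinning `(H, rhoB, B)` of the §4.2 datum of the
record-curve tower along `ι₁`».  Print ([Liu2021] §D.2 l. 5357 + Prop. D.4 (1) p. 130): `H¹_B(Sh, ℂ) ≅ ⊕_π m_disc(π) H¹(𝔤,K;π_∞) ⊗ π^∞`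
(Matsushima [BorelWallach2000, VII 3.2] + Hodge theory, `H¹(𝔤,K;π_∞) ≠ 0` only for the two discrete series `π^{(1,0)}, π^{(0,1)}` of `U(1,1)`,
Lem. D.2) and `m_disc(π^{(1,0)} ⊗ π^∞) + m_disc(π^{(0,1)} ⊗ π^∞) = 1` for endoscopic `π^∞` ([Rogawski1990, §11] via JL).  The two halves are:
* **S1-R `S1RealisationShape`** (REALISATION, size M on the cone road with the scope cut — A-p14 (g14) census `S1R-byname-census` 14280508,
  legs R0–R7): for every Betti pinning `(H, rhoB, B)` of `sec42DataGS S h4 isoₛ` along `ι₁` and every cone frame `𝔣` of `J⋆` at the place of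
  `ι₁`, an INJECTIVE `U(J⋆)(𝔸_{F⁺,f})`-EQUIVARIANT `ℂ`-linear `r : H → (U(J⋆)(𝔸_{F⁺}) → ℂ)` with values in the `(1,0) ⊕ (0,1)` cotangent
  automorphic forms `cohForms₂ 𝔣` of A-p01 (g12)'s CONE carriers ★ `UnitaryCurveCohCotangentForms` (M2, p793416; imported).
  SCOPE CUT of record (F0P5-plan 22:21:35Z): `Injective ∧ (∀ x, r x ∈ cohForms₂) ∧ equivariant` — NOT `range r = cohForms₂` (descent of forms is
  true but unconsumed).  The TYPE SPLIT (`r(H^{1,0}) ≤ hol`, `r(H^{0,1}) ≤ conj hol`) is NOT in this letter: it is orientation-carrying (🟧 — the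
  GS datum's `X_K` is the `c`-CONJUGATE model `M_K ⊗_{F,c} F`, so `bettiH1 ι₁ K` is `H¹` of `M_K` along `conj ∘ ι₁`, and the cone carriers are
  phrased at Mathlib's `(mk ι₁).embedding ∈ {ι₁, conj ∘ ι₁}`; see the census memo `CENSUS-B2s1-S1R-letter.v0.F0P5p01g0.md` §3) and is lettered
  SEPARATELY with F0P5-p04 (sign table) as `S1RealisationHodgeShape` — `S1BettiShape` does not consume it.
* **S1-E2 `S1MultOneFormsShape`** (MULTIPLICITY ≤ 1 ON FORMS, F0P5-p03's slice; XL printed ∕ L–XL quaternion road): under `S1BettiShape`'s binders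
  WITHOUT the tower (`K₀, S, hU7ₛ, h4, isoₛ, H, rhoB, B` dropped) and with a cone frame `𝔣`, the `U(J⋆)(𝔸_{F⁺,f})`-equivariant `ℂ`-linear maps
  `ω⋆_lab → (U(J⋆)(𝔸_{F⁺}) → ℂ)` with values in `cohForms₂ 𝔣` lie on ONE LINE (`∃ ψ₀, ∀ ψ, ∃ a, ψ = a • ψ₀`) — print's
  «`dim Hom_{G(𝔸^∞)}(π^∞, H¹_B) = 1`» for endoscopic `π^∞ ≅ ω(μ,ε,χ)` read as `≤ 1` on the forms side (the [Rogawski1990, §11] ∕ Thm. B.4 ∕ Lem. D.1 (4)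
  inputs are p02's FACT letters; this letter is architecture-neutral: it follows from a hol-line ∕ antihol-line ∕ exclusion triple as in ★
  `F0U3CohMultOne.rank_intertwiningMap_le_one_of_split`, or from a quaternionic JL argument at once).
* **JUNCTION J1 (PROVED, generic algebra `rank_intertwiningMap_le_one_of_line`)**: post-composition with the injective equivariant `r` embeds
  `Hom_{ℂ[G]}(ω⋆_lab, H)` `ℂ`-linearly into the line `ℂ ψ₀`, so its rank is `≤ 1`.  The frame the two letters are applied at is supplied from
  `S1BettiShape`'s own signature binders (`_hsig.1`, `hg`, `_hτt`, `_hτt'`) by the PROVED `nonempty_coneFrame_of_sig` (Sylvester frame of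
  `diag dJ` at `ι₁`, transported through `g⋆` and the twist `embTwist ι₁` to Mathlib's embedding of the place).

HEADS: `s1BettiShape_of : S1RealisationShape → S1MultOneFormsShape → S1BettiShape` (no `sorry` in its own terms) and
`stub_S1_betti_holds : S1BettiShape` (modulo exactly the two stubs) — `S1BettiShape` PASTED token-identically from the parent (:97–131; by import
once `…Lines.F0_AlbCm` is a BUILT farm module: probe rc 75 `remote:stale:10338:unbuilt` 2026-08-30T22:23Z), so the parent's `stub_S1_betti` closes by
`exact F0AlbCmS1Betti.stub_S1_betti_holds`.  No `instance`, no `notation`, no `allowUnsafeReducibility`; `maxHeartbeats 400000` on the junction only.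
[cite: Liu2021, §D.2–§D.3 l. 5300–5359; Prop. D.4 (1) p. 130–131; §4.2 l. 2074–2081] [cite: BorelWallach2000, VII 2.10, 3.2, 3.6; XIII 1.2]
[cite: Borel1997, §5.13–§5.14] [cite: Rogawski1990, §11] [cite: VoisinHodgeI2002, Prop. 6.11, Cor. 7.6]

## References
* [Liu2021] Y. Liu, *Fourier–Jacobi cycles and arithmetic relative trace formula*, Camb. J. Math. 9 (2021) = arXiv:2102.11518: §4.2 l. 2074–2081
  (`H¹_{B,τ'}(A_∞, ℂ)`), §D.2 (D.1) l. 5300–5359 (Matsushima for `Sh(G,h)`), Prop. D.4 (1) p. 130 and its proof p. 130–131.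
* [BorelWallach2000] A. Borel, N. Wallach, *Continuous cohomology, discrete subgroups, and representations of reductive groups*, 2nd ed.: VII 2.10,
  VII 3.2 (Matsushima), VII 3.6, XIII 1.2.
* [Borel1997] A. Borel, *Automorphic forms on SL₂(ℝ)*, §5.13–§5.14 (forms on the quotient ↔ functions on the group).
* [Rogawski1990] J. Rogawski, *Automorphic representations of unitary groups in three variables*, §11 (`U(2)` packets).
* [VoisinHodgeI2002] C. Voisin, *Hodge Theory and Complex Algebraic Geometry I*, Prop. 6.11, Cor. 7.6 (`H¹ = H^{1,0} ⊕ H^{0,1}`).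
-/

set_option autoImplicit false
set_option linter.dupNamespace false

noncomputable section

/-! ## §1–§4: the sub-sub-line proper (v3: the CONE carriers ★ `UnitaryCurveCohCotangentForms` p793416 IMPORTED (v2); `h4` restored in `S1MultOneFormsShape` (ref1-O1)) -/

namespace Summit.HodgeConjecture.HodgeConjecture.Cruxes.HLiu418.F0AlbCmS1BettiHolds

open scoped TensorProduct Matrix NumberField Kronecker ComplexOrder
open NumberField NumberField.InfinitePlace IsDedekindDomain
open Summit.HodgeConjecture.CorCM.Model Summit.HodgeConjecture.CorCM.Model.HComp Summit.HodgeConjecture.CorCM.HComp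
open Literature.AlgebraicGeometry.Motives (CMType AbelianVariety)
open Literature.AlgebraicGeometry.ShimuraVarieties Literature.AlgebraicGeometry.ShimuraVarieties.UnitaryCanonicalModel
open Literature.NumberTheory.Automorphic Literature.NumberTheory.Automorphic.UnitaryGroup Literature.NumberTheory.Automorphic.UnitaryCurveForms
open Literature.NumberTheory.Automorphic.IdeleClassGroup Literature.NumberTheory.Automorphic.Liu2021 Literature.NumberTheory.Automorphic.Liu2021.AppendixC
open Literature.NumberTheory.GaloisRepresentations Literature.RepresentationTheory.Liu2021 Literature.RepresentationTheory.HarrisKudlaSweet1996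
open Literature.AlgebraicGeometry.Liu2021 (IsAdmissibleElement)
open Literature.NumberTheory.Weil1964 Literature.NumberTheory.GelbartRogawski1991 Literature.NumberTheory.GelbartRogawski1991.UnitaryDualPair Literature.NumberTheory.GelbartRogawski1991.UnitaryDualPair.WeilCoinv
open Literature.NumberTheory.GelbartRogawski1991.UnitaryDualPair.LocalSplitting
open Literature.NumberTheory.Automorphic.Liu2021.Def411WeilCarriersDoubling
open Literature.NumberTheory.Automorphic.Liu2021.Def411WeilCarriers (TW JW JW_eq isSymm_TW isUnit_det_TW Rep Eps epsOf Chi rhoVAtLine)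
open Summit.HodgeConjecture.CorCM (CMField)
open Summit.HodgeConjecture.CorCM.Lines.A3Liu418

/-! ### §1 Generic algebra: an injective equivariant realisation into a space where the equivariant maps out of `W` lie on a line -/

section Generic

universe u

variable {k G : Type*} {W H X : Type u} [Field k] [Group G] [AddCommGroup W] [Module k W] [AddCommGroup H] [Module k H]
  [AddCommGroup X] [Module k X]

/-- **JUNCTION ALGEBRA (generic).**  If `H` embeds `G`-equivariantly and `k`-linearly into `X` with values in `A ⊆ X` (`r`), and the
`G`-equivariant `k`-linear maps `W → X` with values in `A` lie on one line `k ψ₀`, then `rank_k Hom_G(W, H) ≤ 1`: post-composition with `r`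
is an INJECTIVE `k`-linear map `Hom_G(W, H) → (W →ₗ X)` with values in `k ∙ ψ₀`, and a module embedding into a cyclic module has rank `≤ 1`
(Mathlib `LinearMap.rank_le_of_injective`, `rank_span_le`). [folklore] -/
theorem rank_intertwiningMap_le_one_of_line (ρ : Representation k G W) (σ : Representation k G H) (R : Representation k G X)
    (A : Submodule k X)
    (hR : ∃ r : H →ₗ[k] X, Function.Injective r ∧ (∀ x, r x ∈ A) ∧ ∀ (g : G) (x : H), r (σ g x) = R g (r x))
    (hL : ∃ ψ₀ : W →ₗ[k] X, ∀ ψ : W →ₗ[k] X,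
      (∀ (g : G) (w : W), ψ (ρ g w) = R g (ψ w)) → (∀ w, ψ w ∈ A) → ∃ a : k, ψ = a • ψ₀) :
    Module.rank k (Representation.IntertwiningMap ρ σ) ≤ 1 := by
  obtain ⟨r, hinj, hmem, heqv⟩ := hR
  obtain ⟨ψ₀, hψ₀⟩ := hL
  -- post-composition with `r`, linear in the intertwiner
  let Φ : Representation.IntertwiningMap ρ σ →ₗ[k] (W →ₗ[k] X) :=
    (LinearMap.llcomp k W H X r) ∘ₗ Representation.IntertwiningMap.toLinearMapl ρ σ
  have hΦapply : ∀ (φ : Representation.IntertwiningMap ρ σ) (w : W), Φ φ w = r (φ w) := fun φ w => rfl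
  have hΦinj : Function.Injective Φ := by
    intro φ φ' h
    apply Representation.IntertwiningMap.ext
    apply LinearMap.ext
    intro w
    have hw := congrArg (fun T : W →ₗ[k] X => T w) h
    simp only [hΦapply] at hw
    exact hinj hw
  have hline : ∀ φ : Representation.IntertwiningMap ρ σ, Φ φ ∈ k ∙ ψ₀ := by
    intro φ
    obtain ⟨a, ha⟩ := hψ₀ (Φ φ)
      (fun g w => by rw [hΦapply, hΦapply, Representation.IntertwiningMap.isIntertwining ρ σ φ g w, heqv])
      (fun w => by rw [hΦapply]; exact hmem _)
    rw [ha]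
    exact Submodule.mem_span_singleton.mpr ⟨a, rfl⟩
  have hcod : Function.Injective (LinearMap.codRestrict (k ∙ ψ₀) Φ hline) := by
    intro φ φ' h
    exact hΦinj (by simpa using congrArg Subtype.val h)
  refine (LinearMap.rank_le_of_injective _ hcod).trans ?_
  refine (rank_span_le _).trans ?_
  simp

end Generic

/-! ### §2 The cone frame of record is ★ `UnitaryCurveForms.nonempty_coneFrame_of_sig` (`Literature/NumberTheory/Automorphic/UnitaryCurveConeFrameOfSig`, p795025);
ED. 1's in-file copy is retired. -/


/-! ### §3 The two letters (Prop texts) and the parent's `S1BettiShape` PASTED token-identically (`Lines/F0_AlbCm.lean` :97–131) -/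

/-- **LETTER S1-R `S1RealisationShape` — REALISATION of the Betti tower of the record curve in the `(1,0) ⊕ (0,1)` cotangent automorphic forms of
`U(J⋆)` (CONE road, scope cut).**  For the §4.2 datum `sec42DataGS S h4 isoₛ` of a curve record `S : RecordSystemGS F J⋆ ι₁ K₀` with its Hecke
translates `sec42HeckeTranslatesGS S hU7ₛ h4 isoₛ`, EVERY Betti pinning `(H, rhoB, B)` along `ι₁` (★ `Sec42Data.BettiPinning`: injective, jointly
exhaustive, Hecke-compatible level maps `H¹((A_K ×_{ι₁} ℂ)(ℂ); ℂ) → H`) and EVERY cone frame `𝔣` of `J⋆` at the place of `ι₁` admit an INJECTIVE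
`ℂ`-linear `r : H → (U(J⋆)(𝔸_{F⁺}) → ℂ)` with values in `cohForms₂ 𝔣` (holomorphic cotangent forms and their conjugates, CONE carriers of
`UnitaryCurveCohCotangentForms`) that is `U(J⋆)(𝔸_{F⁺,f})`-EQUIVARIANT for `rhoB` and right translation `rightRep₂` (`T_g : [v, aK] ↦ [v, agK′]`
pulls back to `f ↦ f(· g)`).  Print: [Liu2021] §D.2 (D.1) at `i = 1` «`H¹_B(Sh, ℂ) ≅ ⊕ m_disc(π) H¹(𝔤,K;π_∞) ⊗ π^∞`» read through Hodge theory
of the compact Riemann surfaces `Γ_q\𝔻` (the record's `pieces`, ★ `UnitaryBallUniformisationDatum 1`; [VoisinHodgeI2002, Cor. 7.6]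
`H¹ = H⁰(Ω¹) ⊕ conj H⁰(Ω¹)`), [Borel1997, §5.14] (forms ↔ functions on the group with the cotangent automorphy factor: ★ `UnitaryBallConeCotangentForms`,
`conePullback_of_smul_eq` = the `IsConeHol` law), [BorelWallach2000, XIII 1.2] (adelic assembly over the pieces), `H¹(Alb X) = H¹(X)` (★
`albanese_bettiOne_pullback_bijective_of_isProjectiveOver`).  SCOPE CUT (F0P5-plan 22:21:35Z; A-p14 census §0): embedding, not `range r = cohForms₂`;
the Hodge TYPE SPLIT is lettered separately (`S1RealisationHodgeShape`, with F0P5-p04's sign table — it carries the 🟧 orientation bit: the GS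
datum's `X_K = M_K ⊗_{F,c} F` is the conjugate model, and the carriers read the place through Mathlib's `(mk ι₁).embedding`).  Why it might fail:
it cannot on the mathematics (injectivity: a cotangent form that is both holomorphic and antiholomorphic on the cone-open with the cotangent
`K_∞`-type vanishes; equivariance: `T_g` is right multiplication by `g` on `[v, aK]`, ★ `RecordSystemGS.IsHeckeTranslate`); size M on the cone road
(legs R0–R7 of the census: M0 ★-to-be `BettiH1Tower`, M1 ★ p791713, M1b, M3 adelic lift, M4 Hecke on cone functions, M5 glue; ≈ 1.3–1.9 kl).
(print: Liu2021, §D.2 l. 5300–5359; §4.2 l. 2074–2081) (print: BorelWallach2000, VII 2.10, 3.2, 3.6; XIII 1.2) (print: Borel1997, §5.13–§5.14)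
(print: VoisinHodgeI2002, Prop. 6.11, Cor. 7.6) (print: BorelJacquet1979, §4.2) -/
def S1RealisationShape : Prop :=
  ∀ (F : CMField) (ι₁ : F →+* ℂ) (Jstar : Matrix (Fin 2) (Fin 2) (F : Type))
    (K₀ : C5.OpenCompactSubgroup ↥(finAdelic ↥(maximalRealSubfield (F : Type)) (F : Type) (IsCMField.complexConj (F : Type)) 2 Jstar))
    (S : RecordSystemGS (F : Type) Jstar ι₁ K₀) (hU7ₛ : S.HeckeTranslateDefinedOver)
    (h4 : 4 ≤ Module.finrank ℚ (F : Type)) (isoₛ : ℕ → Prop)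
    (H : Type) [AddCommGroup H] [Module ℂ H] (rhoB : Representation ℂ (sec42DataGS S h4 isoₛ).G H)
    (B : (sec42DataGS S h4 isoₛ).BettiPinning (sec42HeckeTranslatesGS S hU7ₛ h4 isoₛ) ι₁ H rhoB)
    (𝔣 : ConeFrame (F : Type) Jstar (cmPlace (F : Type) ι₁)),
    ∃ r : H →ₗ[ℂ] ((adelicGroupData ↥(maximalRealSubfield (F : Type)) (F : Type) (IsCMField.complexConj (F : Type)) 2 Jstar).Adelic → ℂ),
      Function.Injective r ∧
      (∀ x : H, r x ∈ cohForms₂ ↥(maximalRealSubfield (F : Type)) (F : Type) (IsCMField.complexConj (F : Type)) Jstar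
          (IsCMField.complexConj_ne_one (F : Type)) (UnitaryGroup.complexConj_smul_infinitePlace (F : Type))
          (cmPlace (F : Type) ι₁) 𝔣) ∧
      ∀ (g : (sec42DataGS S h4 isoₛ).G) (x : H),
        r (rhoB g x) = rightRep₂ ↥(maximalRealSubfield (F : Type)) (F : Type) (IsCMField.complexConj (F : Type)) Jstar g (r x)

/-- **LETTER S1-E2 `S1MultOneFormsShape` — MULTIPLICITY AT MOST ONE OF `ω⋆_lab` IN THE `(1,0) ⊕ (0,1)` COTANGENT AUTOMORPHIC FORMS OF `U(J⋆)`**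
(F0P5-p03's slice; the n = 2 engine row on FORMS).  Binders = `S1BettiShape`'s WITHOUT the tower (`K₀ S hU7ₛ h4 isoₛ H rhoB B` dropped: the statement
is automorphic) and WITH a cone frame `𝔣` at the place of `ι₁`; `ω⋆_lab` = the `Representation ℂ ↥U(J⋆)(𝔸_{F⁺,f})` term of `S1Shape` ∕ `S1BettiShape`
VERBATIM (`rhoVAtLine … (diag dJ) … (hsChiGS … (galConj c μ) …) (r.toFun ε) χ` transported along `finAdelicCongr g⋆`).  Statement: the
`U(J⋆)(𝔸_{F⁺,f})`-equivariant (`rightRep₂`) `ℂ`-linear maps `ψ : ω⋆_lab → (U(J⋆)(𝔸_{F⁺}) → ℂ)` with values in `cohForms₂ 𝔣` lie on ONE LINE.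
Print ([Liu2021] Prop. D.4 (1) p. 130 and its proof p. 130–131): «`Hom_{ℂ[G(𝔸^∞)]}(π^∞, H¹_B(Sh(G,h),ℂ))` has dimension `1`» for endoscopic
cohomological `π^∞ ≅ ω(μ,ε,χ)`, via «inner transfer to `U(V*)` [Har93]; the Langlands–Arthur classification for `U(V*)` is known by [Rog90, §11]; …
`m_disc(π_∞^{(1,0)} ⊗ π^∞) + m_disc(π_∞^{(0,1)} ⊗ π^∞) = 1`»; Thm. B.4; Lem. D.1 (4) — here as `≤ 1` and on the FORMS side of Matsushima
(`U(J⋆)` anisotropic: `F⁺ ≠ ℚ` by `h4`-type degree bounds at the consumer, definite off `ι₁` by `_hsig.2`, so every form is cuspidal and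
`m_disc = dim Hom(π^∞, forms of the given K_∞-type)`).  ARCHITECTURE-NEUTRAL: follows from a hol-line ∕ antihol-line ∕ one-type-vanishes triple
(★ shape `F0U3CohMultOne.StubS3∕S4∕S5` at n = 2, p02's fact letters F1 [Rogawski1990 §11] ∕ F2 [Lem. D.1 (4)] ∕ F3 [Thm. B.4]) by the algebra of ★
`rank_intertwiningMap_le_one_of_split`, or from the quaternion road (`U(2) ↔ B^× × U(1)`, JL + multiplicity one on `GL₂`).  Why it might fail: `ω⋆`
STABLE would give two (D.4 (2)) — excluded, `ω⋆` is a theta lift; the label `galConj`∕`finAdelicCongr` is a relabelling only.  Size XL printed ∕ L–XL.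
(print: Liu2021, Prop. D.4 (1) p. 130–131; §D.2 Lem. D.2 p. 127–129; Thm. B.4; Lem. D.1 (4)) (print: Rogawski1990, §11) (print: BorelWallach2000, VII 3.2) -/
def S1MultOneFormsShape : Prop :=
  ∀ (F : CMField) [IsGalois ℚ F] (ι₁ : F →+* ℂ)
    (μ : Literature.NumberTheory.Automorphic.IdeleClassGroup (F : Type) →ₜ* Circle)
    (hμ : IdeleClassGroup.IsConjugateSymplectic (F : Type) μ)
    (_hw : IdeleClassGroup.HasWeight (F : Type) μ 1)
    (Jstar : Matrix (Fin 2) (Fin 2) (F : Type)) (t : (F : Type)) (ht : t ≠ 0) (_hτt : 0 < (ι₁ t).re) (_hτt' : (ι₁ t).im = 0)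
    (gstar : GL (Fin 2) (F : Type))
    (dJ : Fin 2 → (F : Type)) (hdJ : ∀ i, IsCMField.complexConj (F : Type) (dJ i) = dJ i) (hdJ0 : ∀ i, dJ i ≠ 0)
    (hg : formCongr ((IsCMField.complexConj (F : Type) : (F : Type) ≃ₐ[↥(maximalRealSubfield (F : Type))] (F : Type)) :
        (F : Type) →+* (F : Type)) gstar (t • Jstar) = Matrix.diagonal dJ)
    (_hsig : (∃ Tstar : GL (Fin 2) ℂ,
        formCongr (starRingEnd ℂ) Tstar ((Matrix.diagonal dJ).map ι₁) = Matrix.diagonal ![(1 : ℂ), -1]) ∧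
      ∀ τ' : (F : Type) →+* ℂ, InfinitePlace.mk τ' ≠ InfinitePlace.mk ι₁ → ((Matrix.diagonal dJ).map τ').PosDef)
    (h4 : 4 ≤ Module.finrank ℚ (F : Type))
    (r : Rep ↥(maximalRealSubfield (F : Type)) (imagUnitSq F))
    (ε : Eps ↥(maximalRealSubfield (F : Type)) (imagUnitSq F))
    (_hadm : ∃ e : (F : Type), IsAdmissibleElement (F : Type) hμ.cmType.1 e ∧
      epsOf ↥(maximalRealSubfield (F : Type)) (imagUnitSq F) (F : Type) (2 * imagUnit (F : Type))⁻¹ (-e) = ε)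
    (χ : Chi ↥(maximalRealSubfield (F : Type)) (F : Type) (IsCMField.complexConj (F : Type)))
    (𝔣 : ConeFrame (F : Type) Jstar (cmPlace (F : Type) ι₁)),
    ∃ ψ₀ : Representation.IntertwiningMap
        ((rhoVAtLine ↥(maximalRealSubfield (F : Type)) (F : Type) (IsCMField.complexConj (F : Type)) 2
          (finProdFinEquiv : Fin 2 × Fin 1 ≃ Fin (2 * 1)) (Matrix.diagonal dJ)
          (complexConj_imagUnit F) (imagUnit_ne_zero F) (imagUnit_mul_self F) (realDiagonal_isSymm F dJ hdJ)
          (isUnit_det_realDiagonal F dJ hdJ hdJ0) (realDiagonal_map F dJ hdJ).symm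
          (hsChiGS F finProdFinEquiv dJ hdJ hdJ0
            (toHeckeCharacter (F : Type) (galConj (IsCMField.complexConj (F : Type)) μ))
            (isUnitary_toHeckeCharacter (F : Type) (galConj (IsCMField.complexConj (F : Type)) μ))
            ((isOscillatorChar_toHeckeCharacter_iff (galConj (IsCMField.complexConj (F : Type)) μ)).mpr hμ.galConj))
          (r.toFun ε) χ).comp
          (finAdelicCongr ↥(maximalRealSubfield (F : Type)) (F : Type) (IsCMField.complexConj (F : Type)) gstar ht hg).symm.toMonoidHom)
        (rightRep₂ ↥(maximalRealSubfield (F : Type)) (F : Type) (IsCMField.complexConj (F : Type)) Jstar),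
      ∀ ψ : Representation.IntertwiningMap
        ((rhoVAtLine ↥(maximalRealSubfield (F : Type)) (F : Type) (IsCMField.complexConj (F : Type)) 2
          (finProdFinEquiv : Fin 2 × Fin 1 ≃ Fin (2 * 1)) (Matrix.diagonal dJ)
          (complexConj_imagUnit F) (imagUnit_ne_zero F) (imagUnit_mul_self F) (realDiagonal_isSymm F dJ hdJ)
          (isUnit_det_realDiagonal F dJ hdJ hdJ0) (realDiagonal_map F dJ hdJ).symm
          (hsChiGS F finProdFinEquiv dJ hdJ hdJ0
            (toHeckeCharacter (F : Type) (galConj (IsCMField.complexConj (F : Type)) μ))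
            (isUnitary_toHeckeCharacter (F : Type) (galConj (IsCMField.complexConj (F : Type)) μ))
            ((isOscillatorChar_toHeckeCharacter_iff (galConj (IsCMField.complexConj (F : Type)) μ)).mpr hμ.galConj))
          (r.toFun ε) χ).comp
          (finAdelicCongr ↥(maximalRealSubfield (F : Type)) (F : Type) (IsCMField.complexConj (F : Type)) gstar ht hg).symm.toMonoidHom)
        (rightRep₂ ↥(maximalRealSubfield (F : Type)) (F : Type) (IsCMField.complexConj (F : Type)) Jstar),
      (∀ w, ψ w ∈ cohForms₂ ↥(maximalRealSubfield (F : Type)) (F : Type) (IsCMField.complexConj (F : Type)) Jstar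
          (IsCMField.complexConj_ne_one (F : Type)) (UnitaryGroup.complexConj_smul_infinitePlace (F : Type))
          (cmPlace (F : Type) ι₁) 𝔣) → ∃ a : ℂ, ψ = a • ψ₀

/-- **LETTER S1-R♭ `S1LevelRealisationShape` — the LEVELWISE form of S1-R (PINNING-FREE).**  For the §4.2 datum of a curve record and every
cone frame `𝔣` at the place of `ι₁`: a family of INJECTIVE `ℂ`-linear maps `f_K : H¹_{B,ι₁}(A_K, ℂ) → (U(J⋆)(𝔸_{F⁺}) → ℂ)`, one per
sufficiently small level `K`, with values in `cohForms₂ 𝔣`, compatible with the Hecke translates: `f_K (Alb(T_g)^* y) = R_g (f_{K'} y)`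
for `g⁻¹Kg ⊆ K'` (at `g = 1`: compatibility with the transition pull-backs `Alb_u^*`).  This is what the realisation IS, level by level
([Liu2021] §D.2 (D.1) at finite level: Hodge theory of the compact Riemann surfaces `(M_K)_{ι₁}(ℂ)` + the cone pull-back of `1`-forms +
the adelic assembly over the pieces; [BorelWallach2000, XIII 1.2]); the tower statement `S1RealisationShape` for EVERY Betti pinning
follows by the ★ gluing `Sec42Data.BettiPinning.exists_realisation_of_levelFamily'` (`AppendixC/BettiPinningRealisation`, p795030) —
PROVED below as `s1Realisation_of_levelFamily`.  Binders = `S1PinningShape`'s + `𝔣`; no `(H, rhoB, B)`.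
Size of the proof: M (legs R1–R5 of the census: ★ `albanese_bettiOne_pullback_bijective_of_isProjectiveOver`, ★ Hodge package on the
pieces, ★ M1∕M1b∕M4a cone pull-back and its transport, M3 adelic lift, M4 Hecke translate on cone functions).
(print: Liu2021, §D.3 l. 5300–5359; §4.2 l. 2066–2081) (print: BorelWallach2000, VII 3.2; XIII 1.2) (print: Borel1997, §5.14) -/
def S1LevelRealisationShape : Prop :=
  ∀ (F : CMField) (ι₁ : F →+* ℂ) (Jstar : Matrix (Fin 2) (Fin 2) (F : Type))
    (K₀ : C5.OpenCompactSubgroup ↥(finAdelic ↥(maximalRealSubfield (F : Type)) (F : Type) (IsCMField.complexConj (F : Type)) 2 Jstar))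
    (S : RecordSystemGS (F : Type) Jstar ι₁ K₀) (hU7ₛ : S.HeckeTranslateDefinedOver)
    (h4 : 4 ≤ Module.finrank ℚ (F : Type)) (isoₛ : ℕ → Prop)
    (𝔣 : ConeFrame (F : Type) Jstar (cmPlace (F : Type) ι₁)),
    ∃ f : ∀ K : C5.SmallLevel (sec42DataGS S h4 isoₛ).S.K₀,
        (sec42DataGS S h4 isoₛ).bettiH1 ι₁ K →ₗ[ℂ]
          ((adelicGroupData ↥(maximalRealSubfield (F : Type)) (F : Type) (IsCMField.complexConj (F : Type)) 2 Jstar).Adelic → ℂ),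
      (∀ (K : C5.SmallLevel (sec42DataGS S h4 isoₛ).S.K₀) (y : (sec42DataGS S h4 isoₛ).bettiH1 ι₁ K),
          f K y ∈ cohForms₂ ↥(maximalRealSubfield (F : Type)) (F : Type) (IsCMField.complexConj (F : Type)) Jstar
            (IsCMField.complexConj_ne_one (F : Type)) (UnitaryGroup.complexConj_smul_infinitePlace (F : Type))
            (cmPlace (F : Type) ι₁) 𝔣) ∧
      (∀ K : C5.SmallLevel (sec42DataGS S h4 isoₛ).S.K₀, Function.Injective (f K)) ∧
      ∀ (g : (sec42DataGS S h4 isoₛ).G) (K K' : C5.SmallLevel (sec42DataGS S h4 isoₛ).S.K₀) (h : C5.HeckeLE g K K')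
        (y : (sec42DataGS S h4 isoₛ).bettiH1 ι₁ K'),
        f K (bettiPullAlong ι₁ ((sec42HeckeTranslatesGS S hU7ₛ h4 isoₛ).albTr g K K' h) y) =
          rightRep₂ ↥(maximalRealSubfield (F : Type)) (F : Type) (IsCMField.complexConj (F : Type)) Jstar g (f K' y)

/-- **`S1BettiShape`** — PASTED TOKEN-IDENTICALLY from the parent `Cruxes/HLiu418/Lines/F0_AlbCm.lean` :97–131 (tree d758f6c35589a966); same opens ⟹ same term,
so `F0AlbCm.stub_S1_betti` closes by `exact F0AlbCmS1Betti.stub_S1_betti_holds` (by import once `…Lines.F0_AlbCm` is built; today rc 75 unbuilt).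
[Liu2021, Prop. D.4 (1)] in the BETTI currency: `Module.rank ℂ Hom_{ℂ[G]}(ω⋆, rhoB) ⩽ 1` for every Betti pinning of `sec42DataGS`.
(print: Liu2021, Prop. D.4 (1) p. 130; §D.2 and Lem. D.2 p. 127–129; Thm. B.4; Lem. D.1 (4)) (print: Rogawski1990, §11) -/
def S1BettiShape : Prop :=
  ∀ (F : CMField) [IsGalois ℚ F] (ι₁ : F →+* ℂ)
    (μ : Literature.NumberTheory.Automorphic.IdeleClassGroup (F : Type) →ₜ* Circle)
    (hμ : IdeleClassGroup.IsConjugateSymplectic (F : Type) μ)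
    (_hw : IdeleClassGroup.HasWeight (F : Type) μ 1)
    (Jstar : Matrix (Fin 2) (Fin 2) (F : Type)) (t : (F : Type)) (ht : t ≠ 0) (_hτt : 0 < (ι₁ t).re) (_hτt' : (ι₁ t).im = 0)
    (gstar : GL (Fin 2) (F : Type))
    (dJ : Fin 2 → (F : Type)) (hdJ : ∀ i, IsCMField.complexConj (F : Type) (dJ i) = dJ i) (hdJ0 : ∀ i, dJ i ≠ 0)
    (hg : formCongr ((IsCMField.complexConj (F : Type) : (F : Type) ≃ₐ[↥(maximalRealSubfield (F : Type))] (F : Type)) :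
        (F : Type) →+* (F : Type)) gstar (t • Jstar) = Matrix.diagonal dJ)
    (_hsig : (∃ Tstar : GL (Fin 2) ℂ,
        formCongr (starRingEnd ℂ) Tstar ((Matrix.diagonal dJ).map ι₁) = Matrix.diagonal ![(1 : ℂ), -1]) ∧
      ∀ τ' : (F : Type) →+* ℂ, InfinitePlace.mk τ' ≠ InfinitePlace.mk ι₁ → ((Matrix.diagonal dJ).map τ').PosDef)
    (K₀ : C5.OpenCompactSubgroup ↥(finAdelic ↥(maximalRealSubfield (F : Type)) (F : Type) (IsCMField.complexConj (F : Type)) 2 Jstar))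
    (S : RecordSystemGS (F : Type) Jstar ι₁ K₀) (hU7ₛ : S.HeckeTranslateDefinedOver)
    (h4 : 4 ≤ Module.finrank ℚ (F : Type)) (isoₛ : ℕ → Prop)
    (r : Rep ↥(maximalRealSubfield (F : Type)) (imagUnitSq F))
    (ε : Eps ↥(maximalRealSubfield (F : Type)) (imagUnitSq F))
    (_hadm : ∃ e : (F : Type), IsAdmissibleElement (F : Type) hμ.cmType.1 e ∧
      epsOf ↥(maximalRealSubfield (F : Type)) (imagUnitSq F) (F : Type) (2 * imagUnit (F : Type))⁻¹ (-e) = ε)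
    (χ : Chi ↥(maximalRealSubfield (F : Type)) (F : Type) (IsCMField.complexConj (F : Type)))
    (H : Type) [AddCommGroup H] [Module ℂ H] (rhoB : Representation ℂ (sec42DataGS S h4 isoₛ).G H)
    (_B : (sec42DataGS S h4 isoₛ).BettiPinning (sec42HeckeTranslatesGS S hU7ₛ h4 isoₛ) ι₁ H rhoB),
    Module.rank ℂ (Representation.IntertwiningMap (G := (sec42DataGS S h4 isoₛ).G)
        ((rhoVAtLine ↥(maximalRealSubfield (F : Type)) (F : Type) (IsCMField.complexConj (F : Type)) 2
          (finProdFinEquiv : Fin 2 × Fin 1 ≃ Fin (2 * 1)) (Matrix.diagonal dJ)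
          (complexConj_imagUnit F) (imagUnit_ne_zero F) (imagUnit_mul_self F) (realDiagonal_isSymm F dJ hdJ)
          (isUnit_det_realDiagonal F dJ hdJ hdJ0) (realDiagonal_map F dJ hdJ).symm
          (hsChiGS F finProdFinEquiv dJ hdJ hdJ0
            (toHeckeCharacter (F : Type) (galConj (IsCMField.complexConj (F : Type)) μ))
            (isUnitary_toHeckeCharacter (F : Type) (galConj (IsCMField.complexConj (F : Type)) μ))
            ((isOscillatorChar_toHeckeCharacter_iff (galConj (IsCMField.complexConj (F : Type)) μ)).mpr hμ.galConj))
          (r.toFun ε) χ).comp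
          (finAdelicCongr ↥(maximalRealSubfield (F : Type)) (F : Type) (IsCMField.complexConj (F : Type)) gstar ht hg).symm.toMonoidHom)
        rhoB) ≤ 1

set_option maxHeartbeats 400000 in  -- instance-path defeq `(sec42DataGS S h4 isoₛ).G ≡ ↥(finAdelic … Jstar)`, as in the parent's junction
/-- **S1-R FROM ITS LEVELWISE FORM (PROVED): `S1LevelRealisationShape → S1RealisationShape`** — for EVERY Betti pinning, by the gluing
`Sec42Data.BettiPinning.exists_realisation_of_levelFamily'` (the pinning axioms say `H` is the colimit with the induced Hecke action).
[cite: Liu2021, §4.2 l. 2074–2081; §D.3 l. 5357] [cite: BorelWallach2000, XIII 1.2] -/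
theorem s1Realisation_of_levelFamily (hL : S1LevelRealisationShape) : S1RealisationShape := by
  intro F ι₁ Jstar K₀ S hU7ₛ h4 isoₛ H _ _ rhoB B 𝔣
  obtain ⟨f, hmem, hinj, hhecke⟩ := hL F ι₁ Jstar K₀ S hU7ₛ h4 isoₛ 𝔣
  exact B.exists_realisation_of_levelFamily'
    (rightRep₂ ↥(maximalRealSubfield (F : Type)) (F : Type) (IsCMField.complexConj (F : Type)) Jstar) f
    (cohForms₂ ↥(maximalRealSubfield (F : Type)) (F : Type) (IsCMField.complexConj (F : Type)) Jstar
      (IsCMField.complexConj_ne_one (F : Type)) (UnitaryGroup.complexConj_smul_infinitePlace (F : Type))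
      (cmPlace (F : Type) ι₁) 𝔣)
    hmem hinj hhecke

/-! ### §4 The former stubs, closed by name, and the head -/

/-- **STUB S1-R♭ `stub_S1_levelRealisation : S1LevelRealisationShape`** — the cone-road realisation LEVEL BY LEVEL (size M; legs R1–R5 of the
census; pinning-free) — CLOSED (ed. 3) by ★ `S1LevelRealisation.s1LevelRealisation` (`Theorems/F0AlbCmS1LevelRealisation.lean`).
[cite: Liu2021, §D.2–§D.3 l. 5300–5359] [cite: BorelWallach2000, VII 3.2; XIII 1.2] [cite: Borel1997, §5.14] -/
theorem stub_S1_levelRealisation : S1LevelRealisationShape :=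
  S1LevelRealisation.s1LevelRealisation

/-- **S1-R `stub_S1_realisation : S1RealisationShape` — DERIVED** (no `sorry` of its own): the levelwise stub glued along every pinning.
[cite: Liu2021, §4.2 l. 2074–2081; §D.3 l. 5357] [cite: BorelWallach2000, XIII 1.2] -/
theorem stub_S1_realisation : S1RealisationShape :=
  s1Realisation_of_levelFamily stub_S1_levelRealisation

/-- **S1-E2 `stub_S1_multOneForms : S1MultOneFormsShape` MODULO THE PRINTED-CITATION LETTERS** — multiplicity `≤ 1` on forms: ★ p03
`S1MultOneFormsOfLetters.s1MultOneForms_of_seven_letters`, its two antiholomorphic letters derived from the holomorphic ones by ★ p798131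
(`curveCohFinComponentUnique_antihol_of_hol`, `cohIsotypicLine₂_antihol_of_hol`); the five remaining letters are NAMED FACTS (declared floor-0 debt).
[cite: Liu2021, Prop. D.4 (1) p. 130–131] [cite: Rogawski1990, §11 and Thm. 13.3.6] -/
theorem stub_S1_multOneForms (hE1 : Literature.NumberTheory.Rogawski1990.curveMultiplicityLeOne)
    (hE1'h : Literature.NumberTheory.Rogawski1990.curveCohFinComponentUnique_hol)
    (hE2' : Literature.NumberTheory.Rogawski1990.curveThetaHodgeTypeRigid)
    (hDh : Literature.NumberTheory.Automorphic.UnitaryCurveForms.holCotFormSpectralProjection₂)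
    (hEh : Literature.NumberTheory.Automorphic.UnitaryCurveForms.cohIsotypicLine₂_hol) : S1MultOneFormsShape :=
  S1MultOneFormsOfLetters.s1MultOneForms_of_seven_letters hE1 hE1'h
    (Literature.NumberTheory.Automorphic.UnitaryCurveForms.curveCohFinComponentUnique_antihol_of_hol hE1'h) hE2' hDh hEh
    (Literature.NumberTheory.Automorphic.UnitaryCurveForms.cohIsotypicLine₂_antihol_of_hol hEh)

set_option maxHeartbeats 400000 in
/-- **JUNCTION J1 (PROVED): `S1RealisationShape → S1MultOneFormsShape → S1BettiShape`.**  At the cone frame of `nonempty_coneFrame_of_sig` (from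
`_hsig.1`, `hg`, `_hτt`, `_hτt'`), the realisation `r` of the given pinning and the line `ℂ ψ₀` of equivariant `cohForms₂`-valued maps out of
`ω⋆_lab` feed `rank_intertwiningMap_le_one_of_line`. [cite: Liu2021, Prop. D.4 (1) p. 130; §D.3 l. 5357] [cite: BorelWallach2000, VII 3.2] -/
theorem s1BettiShape_of (hR : S1RealisationShape) (hM : S1MultOneFormsShape) : S1BettiShape := by
  intro F _ ι₁ μ hμ hw Jstar t ht hτt hτt' gstar dJ hdJ hdJ0 hg hsig K₀ S hU7ₛ h4 isoₛ r ε hadm χ H _ _ rhoB B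
  obtain ⟨𝔣⟩ := nonempty_coneFrame_of_sig (F : Type) ι₁ Jstar t hτt hτt' gstar dJ hg hsig.1
  obtain ⟨rr, hinj, hmem, heqv⟩ := hR F ι₁ Jstar K₀ S hU7ₛ h4 isoₛ H rhoB B 𝔣
  obtain ⟨ψ₀, hψ₀⟩ := hM F ι₁ μ hμ hw Jstar t ht hτt hτt' gstar dJ hdJ hdJ0 hg hsig h4 r ε hadm χ 𝔣
  refine rank_intertwiningMap_le_one_of_line _ rhoB
    (rightRep₂ ↥(maximalRealSubfield (F : Type)) (F : Type) (IsCMField.complexConj (F : Type)) Jstar)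
    (cohForms₂ ↥(maximalRealSubfield (F : Type)) (F : Type) (IsCMField.complexConj (F : Type)) Jstar
      (IsCMField.complexConj_ne_one (F : Type)) (UnitaryGroup.complexConj_smul_infinitePlace (F : Type))
      (cmPlace (F : Type) ι₁) 𝔣)
    ⟨rr, hinj, hmem, heqv⟩ ⟨ψ₀.toLinearMap, fun ψ hψG hψA => ?_⟩
  obtain ⟨a, ha⟩ := hψ₀ (ψ.intertwiningMap_of_isIntertwiningMap _ _ hψG) hψA
  refine ⟨a, ?_⟩
  have h := congrArg Representation.IntertwiningMap.toLinearMap ha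
  have h0 : (ψ.intertwiningMap_of_isIntertwiningMap _ _ hψG).toLinearMap = ψ := rfl
  rw [Representation.IntertwiningMap.toLinearMap_smul, h0] at h
  exact h

/-- **`stub_S1_betti_holds : S1BettiShape` — NO `sorry`, MODULO THE FIVE NAMED LETTERS** (E1 `curveMultiplicityLeOne`, E1′-hol
`curveCohFinComponentUnique_hol`, E2′θ `curveThetaHodgeTypeRigid`, TP-hol `holCotFormSpectralProjection₂`, E₂-hol `cohIsotypicLine₂_hol`); the parent
`F0_AlbCm` ed. 4 folds `stub_S1_betti := F0AlbCmS1BettiHolds.stub_S1_betti_holds stub_E1 stub_E1'hol stub_E2' stub_TPhol stub_E₂hol`.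
HC_CM is proved only modulo the 7 printed citations until rung 0 closes. [cite: Liu2021, Prop. D.4 (1) p. 130] -/
theorem stub_S1_betti_holds (hE1 : Literature.NumberTheory.Rogawski1990.curveMultiplicityLeOne)
    (hE1'h : Literature.NumberTheory.Rogawski1990.curveCohFinComponentUnique_hol)
    (hE2' : Literature.NumberTheory.Rogawski1990.curveThetaHodgeTypeRigid)
    (hDh : Literature.NumberTheory.Automorphic.UnitaryCurveForms.holCotFormSpectralProjection₂)
    (hEh : Literature.NumberTheory.Automorphic.UnitaryCurveForms.cohIsotypicLine₂_hol) : S1BettiShape :=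
  s1BettiShape_of stub_S1_realisation (stub_S1_multOneForms hE1 hE1'h hE2' hDh hEh)

end Summit.HodgeConjecture.HodgeConjecture.Cruxes.HLiu418.F0AlbCmS1BettiHolds

end
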